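import Summits.KontsevichZagierPeriods.Zeta5Search.Barrier.ConeGammaCuspSymmetricWalls

/-!
# ζ(5) search — BARRIER: the symmetric part at a junction of ANY wall count — sign from the member-sign PATTERNS

HONEST FRAMING (cell `pub-zeta5`): systematic search; no irrationality claim unless kernel-certified. MODEL objects
under Brown–Zudilin's (28)+(30) accounting ([BZ22] = arXiv:2210.03391; (28) observed, not proved); nothing here is a
statement about `ζ(5)`, any `γ` of record, the cone's supremum (C2 OPEN) or the value of any reflection defect at a
named direction (DATA of the cell); S-E stays CONJECTURED; records in print UNMOVED. Prover P2 g25, companion of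
`ConeGammaCuspSymmetricWalls` (item (c) of P2 g23's list; lead's words lit g37 INBOX l.9223 / l.9232).

`ConeGammaCuspSymmetricWalls` settles single-wall (defect `0`), all-wall (`≥ 0`) and two-wall (one number `D_b`)
junctions. At a breakpoint `b` with ANY member set `M_b = {k : b·h_k(a) ∈ ℤ}` the reflection defect
`𝒩(θ_b+Δ) + 𝒩(θ_b−Δ) − 𝒩(θ_b+t·s) − 𝒩(θ_b−t·s)` of a small displacement `Δ` with non-zero member forms depends only
on the SIGN PATTERN of the member forms at `Δ`, up to global reversal (`torusN_pair_eq_of_member_signs` /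
`_antisigns`) — finitely many values. This file proves the resulting SIGN CRITERION for every wall count:

* **`refl_integrand_sign_of_patterns`** (pointwise, `w ∈ (0, W]` off the member flip points) and
  **`germ_symm_sign_of_patterns`**: if EVERY small displacement with non-zero member forms has reflection defect
  `≥ 0` (it suffices to inspect one displacement per realisable sign pattern), then the four-germ sum
  `R_b(δ) = germR(δ) + germL(δ) + germR(−δ) + germL(−δ)` at `b` is `≥ 0` for EVERY displacement `δ` (scale `0 < η`,
  `ηK < 1`, `ηK < wallDist`); likewise with `≤ 0`. The two-wall theorem `germ_symm_sign_of_two_wall` is the case of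
  two members, where the only patterns are `(+,+) ~ (−,−)` (defect `0`) and `(+,−) ~ (−,+)` (defect `D_b`).
NOT here (honest): any enumeration of realisable patterns or defect values at a named direction (the desk census of
`HOME/pub-zeta5-p2/g25/alg/` is DATA), anything about `γ` of record, C2, S-E, `ζ(5)`.
-/

noncomputable section

open Set MeasureTheory
open scoped Topology

namespace Summit.KontsevichZagierPeriods.Zeta5Search.Barrier.ConeGamma

/-- **The reflection-form integrand as a sum of two reflection defects** (setup shared by the sign criterion and
the two-wall value): at `b ∈ bkpts a T`, for `0 < w ≤ W` and scales `0 < η` (`ηK < 1`, `ηK < wallDist`), `0 < t`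
(`t·x_max < 1`, `< wallDist`), the two displacements `Δ± = η·(w·s(a) ± δ)` are below the wall distance, their forms are
`φ_k(Δ±) = η·(w·h_k ± φ_k(δ))`, and
`[D^{δ}(b+ηw) + D^{−δ}(b−ηw)] + [D^{−δ}(b+ηw) + D^{δ}(b−ηw)] = defect_t(Δ+) + defect_t(Δ−)` with
`defect_t(Δ) = 𝒩(θ_b+Δ) + 𝒩(θ_b−Δ) − (𝒩(θ_b+t·s) + 𝒩(θ_b−t·s))` (the baseline at `ηw` equals the baseline at `t`:
all members are positive along the line, `torusN_pair_eq_of_member_signs`). -/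
theorem refl_integrand_eq_defects {a : Dir} (hpos : ∀ k, 0 < h28 a k) {T b : ℝ} (hb : b ∈ bkpts a T)
    (δ : Fin 8 → ℝ) {η : ℝ} (hη : 0 < η) (h1 : η * clusterBound a δ < 1) (h2 : η * clusterBound a δ < wallDist a T)
    {t : ℝ} (ht : 0 < t) (ht1 : t * xMax a < 1) (ht2 : t * xMax a < wallDist a T) {w : ℝ} (hw0 : 0 < w)
    (hwW : w ≤ clusterWidth a δ) :
    ((∀ k, |phiForm (η • (w • sParam a + δ)) k| < 1) ∧ (∀ k, |phiForm (η • (w • sParam a + δ)) k| < wallDist a T) ∧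
      (∀ k, |phiForm (η • (w • sParam a + -δ)) k| < 1) ∧
      (∀ k, |phiForm (η • (w • sParam a + -δ)) k| < wallDist a T)) ∧
    (∀ (δ' : Fin 8 → ℝ) (k : Fin 28), phiForm (η • (w • sParam a + δ')) k = η * (w * h28 a k + phiForm δ' k)) ∧
    (shiftDiff a δ η (b + η * w) + shiftDiff a (-δ) η (b - η * w)) +
        (shiftDiff a (-δ) η (b + η * w) + shiftDiff a δ η (b - η * w)) =
      ((torusN (b • sParam a + η • (w • sParam a + δ)) : ℝ) + torusN (b • sParam a - η • (w • sParam a + δ)) -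
        (torusN (b • sParam a + t • sParam a) + torusN (b • sParam a - t • sParam a))) +
      ((torusN (b • sParam a + η • (w • sParam a + -δ)) : ℝ) + torusN (b • sParam a - η • (w • sParam a + -δ)) -
        (torusN (b • sParam a + t • sParam a) + torusN (b • sParam a - t • sParam a))) := by
  have hwabs : |w| ≤ clusterWidth a δ := by rw [abs_of_pos hw0]; exact hwW
  have hYn : shiftSize (-δ) ≤ shiftSize δ := (shiftSize_neg δ).le
  have hsmall : ∀ δ' : Fin 8 → ℝ, shiftSize δ' ≤ shiftSize δ →
      (∀ k, |phiForm (η • (w • sParam a + δ')) k| < 1) ∧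
        (∀ k, |phiForm (η • (w • sParam a + δ')) k| < wallDist a T) := fun δ' hδ' =>
    ⟨fun k => (abs_phiForm_disp_le hpos δ hδ' hwabs hη.le k).trans_lt h1,
     fun k => (abs_phiForm_disp_le hpos δ hδ' hwabs hη.le k).trans_lt h2⟩
  have hs : 0 < η * w := mul_pos hη hw0
  have hsx : η * w * xMax a ≤ η * clusterBound a δ := by
    calc η * w * xMax a ≤ η * clusterWidth a δ * xMax a :=
          mul_le_mul_of_nonneg_right (mul_le_mul_of_nonneg_left hwW hη.le) (xMax_pos hpos).le
      _ ≤ η * clusterBound a δ := by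
          rw [mul_assoc]; exact mul_le_mul_of_nonneg_left (clusterWidth_mul_xMax_le_clusterBound a δ) hη.le
  have hform : ∀ (δ' : Fin 8 → ℝ) (k : Fin 28),
      phiForm (η • (w • sParam a + δ')) k = η * (w * h28 a k + phiForm δ' k) := by
    intro δ' k
    rw [show η • (w • sParam a + δ') = η • (w • sParam a) + η • δ' by rw [smul_add], phiForm_add, smul_smul,
      phiForm_smul_sParam, phiForm_eq (η • δ'), pairForm_smul, ← phiForm_eq]
    ring
  -- the baseline at `w` equals the baseline at `t`
  have hlin : ∀ (c : ℝ), 0 < c → c * xMax a < 1 → c * xMax a < wallDist a T →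
      (∀ k, |phiForm (c • sParam a) k| < 1) ∧ (∀ k, |phiForm (c • sParam a) k| < wallDist a T) := fun c hc hc1 hc2 =>
    ⟨fun k => by obtain ⟨e, le⟩ := abs_phiForm_line_step hpos hc k; rw [e]; exact le.trans_lt hc1,
     fun k => by obtain ⟨e, le⟩ := abs_phiForm_line_step hpos hc k; rw [e]; exact le.trans_lt hc2⟩
  have hb1 := hlin _ hs (hsx.trans_lt h1) (hsx.trans_lt h2)
  have hbase := torusN_pair_eq_of_member_signs hb hb1.1 hb1.2 (hlin t ht ht1 ht2).1 (hlin t ht ht1 ht2).2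
    (Δ := (η * w) • sParam a) (Δ' := t • sParam a) fun k _ =>
      Or.inl ⟨by rw [phiForm_smul_sParam]; exact mul_pos hs (hpos k),
        by rw [phiForm_smul_sParam]; exact mul_pos ht (hpos k)⟩
  have hbase' : (torusN (b • sParam a + (η * w) • sParam a) : ℝ) + torusN (b • sParam a - (η * w) • sParam a) =
      torusN (b • sParam a + t • sParam a) + torusN (b • sParam a - t • sParam a) := by exact_mod_cast hbase
  have r1 := shiftDiff_add_shiftDiff_neg_reflect a δ η b w
  have r2 := shiftDiff_add_shiftDiff_neg_reflect a (-δ) η b w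
  rw [neg_neg] at r2
  refine ⟨⟨(hsmall δ le_rfl).1, (hsmall δ le_rfl).2, (hsmall _ hYn).1, (hsmall _ hYn).2⟩, hform, ?_⟩
  rw [r1, r2, hbase']

/-- **Pointwise sign of the reflection-form integrand from the patterns.** At `b ∈ bkpts a T`, for `w ∈ (0, W]` at
which no MEMBER form of `w·s(a) ± δ` vanishes, the reflection-form integrand is `≥ 0` as soon as every small
displacement with non-zero member forms has reflection defect `≥ 0` against the line step `t` — and `≤ 0` in the
mirrored case. -/
theorem refl_integrand_sign_of_patterns {a : Dir} (hpos : ∀ k, 0 < h28 a k) {T b : ℝ} (hb : b ∈ bkpts a T)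
    (δ : Fin 8 → ℝ) {η : ℝ} (hη : 0 < η) (h1 : η * clusterBound a δ < 1) (h2 : η * clusterBound a δ < wallDist a T)
    {t : ℝ} (ht : 0 < t) (ht1 : t * xMax a < 1) (ht2 : t * xMax a < wallDist a T) {w : ℝ} (hw0 : 0 < w)
    (hwW : w ≤ clusterWidth a δ)
    (hflip : ∀ k, (∃ z : ℤ, b * h28 a k = z) → w * h28 a k + phiForm δ k ≠ 0 ∧ w * h28 a k - phiForm δ k ≠ 0) :
    ((∀ Δ : Fin 8 → ℝ, (∀ k, |phiForm Δ k| < 1) → (∀ k, |phiForm Δ k| < wallDist a T) →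
        (∀ k, (∃ z : ℤ, b * h28 a k = z) → phiForm Δ k ≠ 0) →
        0 ≤ (torusN (b • sParam a + Δ) : ℝ) + torusN (b • sParam a - Δ) -
          (torusN (b • sParam a + t • sParam a) + torusN (b • sParam a - t • sParam a))) →
      0 ≤ (shiftDiff a δ η (b + η * w) + shiftDiff a (-δ) η (b - η * w)) +
        (shiftDiff a (-δ) η (b + η * w) + shiftDiff a δ η (b - η * w))) ∧
    ((∀ Δ : Fin 8 → ℝ, (∀ k, |phiForm Δ k| < 1) → (∀ k, |phiForm Δ k| < wallDist a T) →
        (∀ k, (∃ z : ℤ, b * h28 a k = z) → phiForm Δ k ≠ 0) →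
        (torusN (b • sParam a + Δ) : ℝ) + torusN (b • sParam a - Δ) -
          (torusN (b • sParam a + t • sParam a) + torusN (b • sParam a - t • sParam a)) ≤ 0) →
      (shiftDiff a δ η (b + η * w) + shiftDiff a (-δ) η (b - η * w)) +
        (shiftDiff a (-δ) η (b + η * w) + shiftDiff a δ η (b - η * w)) ≤ 0) := by
  obtain ⟨⟨hDp1, hDp2, hDm1, hDm2⟩, hform, hF⟩ := refl_integrand_eq_defects hpos hb δ hη h1 h2 ht ht1 ht2 hw0 hwW
  have hnzp : ∀ k, (∃ z : ℤ, b * h28 a k = z) → phiForm (η • (w • sParam a + δ)) k ≠ 0 := fun k hk => by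
    rw [hform]; exact mul_ne_zero hη.ne' (hflip k hk).1
  have hnzm : ∀ k, (∃ z : ℤ, b * h28 a k = z) → phiForm (η • (w • sParam a + -δ)) k ≠ 0 := fun k hk => by
    rw [hform, phiForm_neg, ← sub_eq_add_neg]; exact mul_ne_zero hη.ne' (hflip k hk).2
  rw [hF]
  exact ⟨fun hP => add_nonneg (hP _ hDp1 hDp2 hnzp) (hP _ hDm1 hDm2 hnzm),
    fun hN => by linarith [hN _ hDp1 hDp2 hnzp, hN _ hDm1 hDm2 hnzm]⟩

/-- **THE SIGN CRITERION AT A JUNCTION OF ANY WALL COUNT.** At a breakpoint `b ∈ bkpts a T` (all 28 forms of `a`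
positive), for every displacement `δ` and every scale `0 < η` with `ηK < 1`, `ηK < wallDist`, and a line step `t > 0`
with `t·x_max < 1`, `t·x_max < wallDist`: if every small displacement `Δ` (forms `< 1` and `< wallDist`) with
NON-ZERO member forms has reflection defect `𝒩(θ_b+Δ) + 𝒩(θ_b−Δ) − 𝒩(θ_b+t·s) − 𝒩(θ_b−t·s) ≥ 0`, then the four-germ
sum `R_b(δ)` is `≥ 0`; if every such defect is `≤ 0`, then `R_b(δ) ≤ 0`. (By `torusN_pair_eq_of_member_signs` /
`_antisigns` the hypothesis is a check of finitely many values, one per realisable member-sign pattern up to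
reversal; the integrand is controlled a.e. on `[0, W]`, off `{0} ∪ {∓φ_k(δ)/h_k}`.) -/
theorem germ_symm_sign_of_patterns {a : Dir} (hpos : ∀ k, 0 < h28 a k) {T b : ℝ} (hb : b ∈ bkpts a T)
    (δ : Fin 8 → ℝ) {η : ℝ} (hη : 0 < η) (h1 : η * clusterBound a δ < 1) (h2 : η * clusterBound a δ < wallDist a T)
    {t : ℝ} (ht : 0 < t) (ht1 : t * xMax a < 1) (ht2 : t * xMax a < wallDist a T) :
    ((∀ Δ : Fin 8 → ℝ, (∀ k, |phiForm Δ k| < 1) → (∀ k, |phiForm Δ k| < wallDist a T) →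
        (∀ k, (∃ z : ℤ, b * h28 a k = z) → phiForm Δ k ≠ 0) →
        0 ≤ (torusN (b • sParam a + Δ) : ℝ) + torusN (b • sParam a - Δ) -
          (torusN (b • sParam a + t • sParam a) + torusN (b • sParam a - t • sParam a))) →
      0 ≤ germR a δ η b + germL a δ η b + germR a (-δ) η b + germL a (-δ) η b) ∧
    ((∀ Δ : Fin 8 → ℝ, (∀ k, |phiForm Δ k| < 1) → (∀ k, |phiForm Δ k| < wallDist a T) →
        (∀ k, (∃ z : ℤ, b * h28 a k = z) → phiForm Δ k ≠ 0) →
        (torusN (b • sParam a + Δ) : ℝ) + torusN (b • sParam a - Δ) -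
          (torusN (b • sParam a + t • sParam a) + torusN (b • sParam a - t • sParam a)) ≤ 0) →
      germR a δ η b + germL a δ η b + germR a (-δ) η b + germL a (-δ) η b ≤ 0) := by
  rw [germ_symm_eq_integral_refl]
  have hW := clusterWidth_pos hpos δ
  -- the exceptional set: `0` and the member flip points `∓φ_k(δ)/h_k` (all 28 `k`, a finite set)
  set B : Set ℝ := {0} ∪ ⋃ k : Fin 28, {(-phiForm δ k) / h28 a k, phiForm δ k / h28 a k} with hBdef
  have hBfin : B.Finite := by
    rw [hBdef]
    exact (Set.finite_singleton _).union (Set.finite_iUnion fun k => (Set.finite_singleton _).insert _)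
  have hae : ∀ᵐ w ∂volume, w ∉ B := (measure_eq_zero_iff_ae_notMem).mp (hBfin.measure_zero volume)
  have hoff : ∀ w, w ∉ B → w ∈ Icc 0 (clusterWidth a δ) → 0 < w ∧ ∀ k, (∃ z : ℤ, b * h28 a k = z) →
      w * h28 a k + phiForm δ k ≠ 0 ∧ w * h28 a k - phiForm δ k ≠ 0 := by
    intro w hwB hwI
    refine ⟨lt_of_le_of_ne hwI.1 fun h => hwB (by rw [hBdef, ← h]; exact Or.inl rfl), fun k _ => ?_⟩
    have hk := hpos k
    have nm : ∀ c : ℝ, (c / h28 a k ∈ ({(-phiForm δ k) / h28 a k, phiForm δ k / h28 a k} : Set ℝ)) →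
        w ≠ c / h28 a k := fun c hc h =>
      hwB (by rw [hBdef]; exact Or.inr (Set.mem_iUnion.mpr ⟨k, h ▸ hc⟩))
    exact ⟨fun h => nm (-phiForm δ k) (Or.inl rfl) (by field_simp; linarith),
      fun h => nm (phiForm δ k) (Or.inr rfl) (by field_simp; linarith)⟩
  constructor
  · intro hP
    refine intervalIntegral.integral_nonneg_of_ae_restrict hW.le ?_
    rw [Filter.EventuallyLE, ae_restrict_iff' measurableSet_Icc]
    filter_upwards [hae] with w hwB hwI
    obtain ⟨hw0, hflip⟩ := hoff w hwB hwI
    exact (refl_integrand_sign_of_patterns hpos hb δ hη h1 h2 ht ht1 ht2 hw0 hwI.2 hflip).1 hP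
  · intro hN
    rw [← neg_nonneg, ← intervalIntegral.integral_neg]
    refine intervalIntegral.integral_nonneg_of_ae_restrict hW.le ?_
    rw [Filter.EventuallyLE, ae_restrict_iff' measurableSet_Icc]
    filter_upwards [hae] with w hwB hwI
    obtain ⟨hw0, hflip⟩ := hoff w hwB hwI
    have := (refl_integrand_sign_of_patterns hpos hb δ hη h1 h2 ht ht1 ht2 hw0 hwI.2 hflip).2 hN
    simp only [Pi.zero_apply]
    linarith

end Summit.KontsevichZagierPeriods.Zeta5Search.Barrier.ConeGamma

end
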